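import Summits.ResolutionOfSingularities.ResolutionOfSingularities.Theorems.WildConesCampaignW46HypersurfacesCharTwoEmbDimDefs
import Summits.ResolutionOfSingularities.ResolutionOfSingularities.Theorems.WildConesCampaignW46HypersurfacesCharTwoHilbertDefs
import Mathlib.Algebra.CharP.Defs
import Mathlib.LinearAlgebra.Matrix.Rank

/-!
# [OURS · L1 W4.6, rung (ii)] STATEMENTS of the embedding-dimension package — the hyperbolic-splitting
# regime `e ≤ 1` of hypersurface `p`-fold points IN EVERY DIMENSION `n` (instance `p = 2` proved for all `n`)
# over route WildCones' point-blow-up dynamics — campaign s46 of cell res-hironaka (LADDER-RESOLUTION rung L,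
# D-0089); host route WildCones, `--kind definition --supports stmt-ResolutionOfSingularities-16884`

HONEST FRAMING. Everything below is OURS (campaign statements of slot W4.6, typed by the prover res-L1-s46-pv-4
(gen 3) in the pattern of `Theorems/WildConesCampaignW46ThreefoldsCharTwoRegimeStatement.lean` (p485552, OURS-desk
#64, lanes A/B 10/10): predicates `def … (p n : ℕ) : Prop` in the characteristic AND THE DIMENSION, one decl per
statement, no theorem, no `sorry`) over route WildCones' typed point-blow-up dynamics
(`Theorems/WildConesClassicalRegimesDefs.lean`: states `c : (Fin n → ℕ) → κ` = coefficients of `a(u₁,…,uₙ)` in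
`z^p = a`, `step i τ c` = blow up the point, chart `u_i`, translate by `τ`, delete `p`-th powers; `MultP` = cleaned
order `≥ p`, `OrdP` = a cleaned monomial of degree `p`, `Isol` = finite Milnor algebra `κ⟦u⟧/(∂a)`, `mu` = its
dimension) and the seat's invariant of `Theorems/WildConesCampaignW46HypersurfacesCharTwoEmbDimDefs.lean` (p498937):
`CampaignW46.milnorEmbDim p n κ c = e(c)` = the EMBEDDING DIMENSION `dim_κ 𝔪_A/𝔪_A²` of the Milnor algebra
`A = κ⟦u⟧/(∂a)` (`= n −` rank of the linear parts of the partials; for a double point in characteristic `2`: the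
CORANK OF THE POLAR FORM of the cleaned quadratic part). They are NOT statements of H. Hironaka's manuscript
[Hironaka2017] and use nothing from it; each docstring says which printed item's ROLE the statement replaces
(Th. 16.6 p.84, §16.3 / Th. 16.13 p.87), under adjudication, never as fact. No FACT-LIST premise occurs. AI
bookkeeping, weaker than expert review.

WHY (every `n`). Gen 2 (desk #64) typed the THREEFOLD package in the order-`p`-cleaned regime `MultP ∧ OrdP ∧ Isol`.
For `n ≥ 4` that regime is NOT closed (`CampaignW46FourfoldsSplittingNotClosed`, `…FivefoldsSplittingNotClosed`,
p485552). The regime that IS closed in every dimension is `MultP ∧ Isol ∧ e ≤ 1`; for `n = 3` it coincides with the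
old one (`CampaignW46ThreefoldsEmbDimIffOrdP` below). The `p = 2` instances of all eight predicates are PROVED, for
every `n`, in `Theorems/WildConesCampaignW46HypersurfacesCharTwoEmbDim{,States,Dynamics}.lean` (closers by name in
`…EmbDimProof.lean`); other `p` are not claimed (and `EmbDimParity` is specific to `p = 2`, where the polar form is
alternating).

VACUITY (at `p = 2`). Not vacuous: `e = 1` with a double successor on `z² = u₀u₁ + u₂^(2j+1)`, `j ≥ 2` (p470498,
`n = 3`); `e = 0` on `z² = u₀u₁` (`n = 2`, `μ = 1`); `e = 2, 3` with double successors on p485483 / p484275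
(`n = 4, 5`); the conclusions (isolatedness of the successor, the drop by two, evenness) are not bookkeeping — they
fail outside the regime.

REV 2 (same seat, 2026-08-27, APPEND-ONLY: the eight rev-1 predicates are byte-identical; four predicates appended):
`CampaignW46HypersurfacesEmbDimNearPointUnique` (at most one infinitely-near `p`-fold point when `e ≤ 1`),
`CampaignW46HypersurfacesEmbDimNearPointExists` (`e = 1`, `n ≥ 3`: a `p`-fold successor exists iff `μ ≥ 4`),
`CampaignW46HypersurfacesEmbDimSingularBranch` (`e = 1`, `n ≥ 3`: one chain of exactly `μ/2` `p`-fold points, then a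
smooth point), `CampaignW46HypersurfacesEmbDimPolarCorank` (`e(c) + rank` of the polar matrix `= n`, the matrix spelled
out). Their `p = 2` instances are PROVED for every `n` in `…HypersurfacesCharTwo{NearPoint,NearPointExists,SingularBranch,
PolarRank}.lean` (p503790, p505045, p505446, p502936); closers by name in `…EmbDimNearPointProof.lean`.

REV 3 (same seat, gen 4, 2026-08-27, APPEND-ONLY: the twelve rev-1/rev-2 predicates are byte-identical; six
predicates appended, one import added — `…HypersurfacesCharTwoHilbertDefs.lean`, p511581, for the invariant
`CampaignW46.milnorHilbertTwo p n κ c = h₂(c) = dim_κ 𝔪_A²/𝔪_A³`, the value at `2` of the Hilbert function of the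
Milnor algebra `A`; six predicates appended): THE CASE `e = 2`, which rev 1's `CampaignW46HypersurfacesEmbDimTrichotomy`
left undecided («the value `e = 2` decides nothing»; kernel witnesses both ways p507619), IS DECIDED BY `h₂`:
`CampaignW46HypersurfacesEmbDimTwoHilbertRange` (`e = 2 ⇒ h₂ ∈ {1,2,3}`), `CampaignW46HypersurfacesEmbDimTwoNoTangent`
(`e = 2`, `h₂ = 3` ⇒ every `p`-fold successor NON-isolated), `CampaignW46HypersurfacesEmbDimTwoThreeTangents` (`e = 2`,
`h₂ = 1` ⇒ every `p`-fold successor has `e = 0`, `μ = 1`, and no `p`-fold point after it),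
`CampaignW46HypersurfacesEmbDimTwoIsolated` (ISOLATED, `e = 2`, `h₂ ≤ 2` ⇒ every `p`-fold successor isolated, `μ` drops),
`CampaignW46HypersurfacesIsolStepCriterion` (ISOLATED state, `p`-fold successor: successor isolated
`⇔ e ≤ 1 ∨ (e = 2 ∧ h₂ ≤ 2)`), and `CampaignW46HypersurfacesEmbDimMonotone` (`e(successor) ≤ e(c)` for every `p`-fold
state with a `p`-fold successor). Their `p = 2` instances are PROVED for every `n` in
`…HypersurfacesCharTwo{Hilbert,TangentLeaf,TangentCone,IsolTransferLeaf,IsolTransfer,EmbDimMonotone}.lean` (p512443,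
p513188, p513980, p513984, the IsolTransfer and the EmbDimMonotone files); closers by name in
`…HypersurfacesCharTwoEmbDimTwoProof.lean`. At `p = 2`,
after splitting all hyperbolic pairs `u_ju_l` (Greuel–Pfister) an `e = 2` state leaves a plane germ `g(x,y)` of order
`≥ 3` modulo squares, and `h₂ = 3 −` rank of the Jacobian pair of (diagonal) quadratic forms of its cubic part:
`h₂ = 1` ⇔ three distinct tangents, `h₂ = 3` ⇔ no tangent cubic.

REV 4 (same seat, gen 4, 2026-08-27, APPEND-ONLY: the eighteen rev-1/2/3 predicates are byte-identical; two predicates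
appended): THE `D₄` CLASS — `CampaignW46HypersurfacesEmbDimTwoDFour` (for a `p`-fold state with `e = 2`: `h₂ = 1` iff the
state is ISOLATED with `μ = 4`) and `CampaignW46HypersurfacesEmbDimTwoDropThree` (`e = 2`, `h₂ = 1`, `p`-fold successor:
`μ(successor) + 3 = μ`). Their `p = 2` instances are PROVED for every `n` in `…HypersurfacesCharTwoDFour.lean` (Nakayama on
`𝔪³ ≤ (∂a) + 𝔪⁴` in the residual plane; the converse from `h₂ + e + 1 ≤ μ`, `…HilbertWitness.lean`, p517132); closers by
name appended to `…HypersurfacesCharTwoEmbDimTwoProof.lean`. Non-vacuity of rev 3/rev 4 in the kernel (p517132,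
`fourfold_hilbertTwo_witnesses`): `u₀u₁ + u₂²u₃ + u₂u₃²` has `e = 2`, `h₂ = 1`, `μ = 4`, isolated double successor with `μ = 1`;
`u₀u₁ + u₂⁵ + u₃⁵` has `e = 2`, `h₂ = 3`, non-isolated double successor.

REV 5 (same seat, gen 4, APPEND-ONLY: twenty predicates byte-identical; one appended): `CampaignW46HypersurfacesEmbDimTwoExit`
— how the forced regime is LEFT when `e ≤ 2` (proved at `p = 2` for every `n` in `…HypersurfacesCharTwoSidewaysExit.lean`,
p518449; closer appended to `…EmbDimTwoProof.lean`).

## References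

* res-L1-s46-pv-4 gens 0–3, files `Theorems/WildConesCampaignW46{Threefolds,Hypersurfaces}CharTwo*.lean` (all
  ACCEPTED, --supports stmt-16884); route file Theses/WildCones.lean (`ClassicalRegimes`, stmt-16884).
* H. Hironaka, ms. 2017-03-23 [Hironaka2017]: Th. 16.6 p.84 L3–L16 (centre `D ⊂ ∇(E)`, `D′ = ∇′ ∩ π⁻¹(D)`,
  Eq. (127)); §16.3 p.87 L14–L24; Th. 16.13 p.87 L25–L28 — quoted for the ROLE replaced only, under adjudication.
* G.-M. Greuel, G. Pfister, The splitting lemma in any characteristic, J. Algebra 689 (2026) [GreuelPfister2026] —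
  context for the proofs (the tree's `WildCones.MuDropCharTwoOrdP.pair_reduction`), not a premise here.
-/

noncomputable section

set_option linter.dupNamespace false -- mandated namespace of this single-conjunct summit

open MvPowerSeries

namespace Summit.ResolutionOfSingularities.ResolutionOfSingularities.Theorems

/-- [OURS · L1 W4.6 rung (ii), every dimension] replaces the role of Th. 16.6 (2) Eq. (127) p.84 L9–L16 TOGETHER
WITH the renewal of the procedure's hypotheses at the next stage (§16.3 p.87 L17–L18) for HYPERSURFACE `p`-FOLD
POINTS `z^p = a(u₁,…,uₙ)` in the regime «isolated, Milnor algebra of embedding dimension `≤ 1`» of route WildCones'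
point-blow-up dynamics; NOT a statement of the manuscript. For every field `κ` of characteristic `p`, every state
`c` with `MultP ∧ Isol ∧ e(c) ≤ 1` and every chart `i`, translation `τ` whose successor is again a `p`-fold point:
the successor is ISOLATED, `μ(successor) + 2 = μ(c)`, and `e(successor) = e(c)`. Instance `p = 2` PROVED for every
`n` by `CampaignW46.HypersurfacesCharTwo.hypersurface_regime_step`; other `p` not claimed. [folklore] -/
def CampaignW46HypersurfacesEmbDimClosed (p n : ℕ) : Prop :=
  ∀ (κ : Type) [Field κ] [CharP κ p] (c : (Fin n → ℕ) → κ) (i : Fin n) (τ : Fin n → κ),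
    WildCones.MultP p n κ c → WildCones.Isol p n κ c → CampaignW46.milnorEmbDim p n κ c ≤ 1 →
      WildCones.MultP p n κ (WildCones.step p n κ i τ c) →
        WildCones.Isol p n κ (WildCones.step p n κ i τ c) ∧
          WildCones.mu p n κ (WildCones.step p n κ i τ c) + 2 = WildCones.mu p n κ c ∧
          CampaignW46.milnorEmbDim p n κ (WildCones.step p n κ i τ c) = CampaignW46.milnorEmbDim p n κ c

/-- [OURS · L1 W4.6 rung (ii), every dimension] replaces the role of the centre-type bookkeeping of the iterated
procedure (Th. 16.6 p.84 L4–L6: the next centre `D′ ⊂ ∇′`; §16.3 p.87 L14–L16) — «is the next singular point again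
ISOLATED?» — for hypersurface `p`-fold points in route WildCones' dynamics, by a TRICHOTOMY on the embedding
dimension of the current state; NOT a statement of the manuscript. For every field `κ` of characteristic `p`, every
ISOLATED `p`-fold state `c` and every chart/translation whose successor is a `p`-fold point: `e(c) ≤ 1 ⇒` the
successor is isolated; `e(c) ≥ 3 ⇒` it is NOT (the value `e = 2` decides nothing). Instance `p = 2` PROVED for every
`n` by `CampaignW46.HypersurfacesCharTwo.hypersurface_trichotomy` (for `n = 3` it is desk #64's
`CampaignW46ThreefoldsForcedDichotomy`, `e ∈ {1, 3}` there); other `p` not claimed. [folklore] -/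
def CampaignW46HypersurfacesEmbDimTrichotomy (p n : ℕ) : Prop :=
  ∀ (κ : Type) [Field κ] [CharP κ p] (c : (Fin n → ℕ) → κ) (i : Fin n) (τ : Fin n → κ),
    WildCones.MultP p n κ c → WildCones.Isol p n κ c → WildCones.MultP p n κ (WildCones.step p n κ i τ c) →
      (CampaignW46.milnorEmbDim p n κ c ≤ 1 → WildCones.Isol p n κ (WildCones.step p n κ i τ c)) ∧
        (3 ≤ CampaignW46.milnorEmbDim p n κ c → ¬ WildCones.Isol p n κ (WildCones.step p n κ i τ c))

/-- [OURS · L1 W4.6 rung (ii), every dimension] replaces the role of NOTHING printed (bookkeeping of OUR invariant);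
NOT a statement of the manuscript. For every field `κ` of characteristic `p` and every `p`-fold state `c` of
`z^p = a(u₁,…,uₙ)`: `e(c) ≤ n` and `e(c) ≡ n (mod 2)`. Instance `p = 2` PROVED for every `n` by
`CampaignW46.HypersurfacesCharTwo.milnorEmbDim_le_and_mod_two` (the polar form of a characteristic-two double point
is ALTERNATING, so its rank `n − e` is even); the predicate is specific to `p = 2` and other `p` are not claimed.
[folklore] -/
def CampaignW46HypersurfacesEmbDimParity (p n : ℕ) : Prop :=
  ∀ (κ : Type) [Field κ] [CharP κ p] (c : (Fin n → ℕ) → κ),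
    WildCones.MultP p n κ c → CampaignW46.milnorEmbDim p n κ c ≤ n ∧ CampaignW46.milnorEmbDim p n κ c % 2 = n % 2

/-- [OURS · L1 W4.6 rung (ii), every dimension] replaces the role of NOTHING printed (dictionary between the order
predicate `OrdP` of crux `ClassicalRegimes` and OUR invariant); NOT a statement of the manuscript. For every field
`κ` of characteristic `p` and every `p`-fold state `c` of `z^p = a(u₁,…,uₙ)`: `c` is order-`p` cleaned (`OrdP`) iff
`e(c) + 2 ≤ n`. Instance `p = 2` PROVED for every `n` by
`CampaignW46.HypersurfacesCharTwo.ordP_iff_milnorEmbDim_add_two_le`; other `p` not claimed. [folklore] -/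
def CampaignW46HypersurfacesEmbDimOrdP (p n : ℕ) : Prop :=
  ∀ (κ : Type) [Field κ] [CharP κ p] (c : (Fin n → ℕ) → κ),
    WildCones.MultP p n κ c → (WildCones.OrdP p n κ c ↔ CampaignW46.milnorEmbDim p n κ c + 2 ≤ n)

/-- [OURS · L1 W4.6 rung (ii), every dimension] replaces the role of Th. 16.13 p.87 L25–L28 in the DEGENERATE
sub-case «resolved by ONE blow-up» for hypersurface `p`-fold points of route WildCones' dynamics; NOT a statement
of the manuscript. For every field `κ` of characteristic `p` and every `p`-fold state `c`: `e(c) = 0` iff `c` is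
isolated with `μ(c) = 1`; and then NO successor `step i τ c` (any chart, any translation) is a `p`-fold point.
Instance `p = 2` PROVED for every `n` by `CampaignW46.HypersurfacesCharTwo.milnorEmbDim_eq_zero_iff` and
`…hypersurface_not_multP_step_of_milnorEmbDim_eq_zero`; other `p` not claimed. [folklore] -/
def CampaignW46HypersurfacesEmbDimZero (p n : ℕ) : Prop :=
  ∀ (κ : Type) [Field κ] [CharP κ p] (c : (Fin n → ℕ) → κ), WildCones.MultP p n κ c →
    (CampaignW46.milnorEmbDim p n κ c = 0 ↔ WildCones.Isol p n κ c ∧ WildCones.mu p n κ c = 1) ∧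
      (CampaignW46.milnorEmbDim p n κ c = 0 →
        ∀ (i : Fin n) (τ : Fin n → κ), ¬ WildCones.MultP p n κ (WildCones.step p n κ i τ c))

/-- [OURS · L1 W4.6 rung (ii), every dimension] replaces the role of NOTHING printed (the budget of OUR termination
argument: structure of the Milnor algebra in the regime); NOT a statement of the manuscript. For every field `κ` of
characteristic `p` and every ISOLATED `p`-fold state `c` of `z^p = a(u₁,…,uₙ)` with `e(c) = 1`: `μ(c)` is EVEN,
`μ(c) ≥ 2`, and the Milnor algebra `κ⟦u⟧/(∂a)` is `κ`-isomorphic to `κ⟦X⟧/(X^μ)`. Instance `p = 2` PROVED for every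
`n` by `CampaignW46.HypersurfacesCharTwo.curvilinear_of_milnorEmbDim_eq_one` (desk #64's
`CampaignW46ThreefoldsMilnorEven` is the case `n = 3`); other `p` not claimed.
[cite: GreuelPfister2026, Thm 3.5 and Cor 3.7] -/
def CampaignW46HypersurfacesEmbDimOne (p n : ℕ) : Prop :=
  ∀ (κ : Type) [Field κ] [CharP κ p] (c : (Fin n → ℕ) → κ),
    WildCones.MultP p n κ c → WildCones.Isol p n κ c → CampaignW46.milnorEmbDim p n κ c = 1 →
      Even (WildCones.mu p n κ c) ∧ 2 ≤ WildCones.mu p n κ c ∧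
        Nonempty ((MvPowerSeries (Fin n) κ ⧸ WildCones.jac p n κ c) ≃ₐ[κ]
          (MvPowerSeries (Fin 1) κ ⧸ Ideal.span {(X 0 : MvPowerSeries (Fin 1) κ) ^ WildCones.mu p n κ c}))

/-- [OURS · L1 W4.6 rung (ii), every dimension] replaces the role of Th. 16.13 p.87 L25–L28 («by applying Th.(16.6)
… repeatedly but finitely many times … we obtain the resolution of singularities») and of §16.3 p.87 L18–L24 for
HYPERSURFACE `p`-FOLD POINTS `z^p = a(u₁,…,uₙ)`, `n ≥ 2`, in the regime «isolated, `e ≤ 1`» of route WildCones'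
point-blow-up dynamics, WITH A NUMBER; NOT a statement of the manuscript. For every field `κ` of characteristic `p`,
every isolated `p`-fold state `c₀` with `e(c₀) ≤ 1`, every chart word `i` and translation word `t`: at some stage `m`
with `2m ≤ μ(c₀) + 1` the cleaned state has a LINEAR monomial (the transform is SMOOTH at the visited point), and
every earlier state `k < m` is an isolated `p`-fold point with `e = e(c₀)` and `μ + 2k = μ(c₀)`. Instance `p = 2`
PROVED for every `n ≥ 2` by `CampaignW46.HypersurfacesCharTwo.hypersurface_smooth_le_half` (desk #64's
`CampaignW46ThreefoldsSplittingResolves` is `n = 3`); other `p` not claimed. [folklore] -/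
def CampaignW46HypersurfacesEmbDimResolves (p n : ℕ) : Prop :=
  2 ≤ n → ∀ (κ : Type) [Field κ] [CharP κ p] (c₀ : (Fin n → ℕ) → κ) (i : ℕ → Fin n) (t : ℕ → Fin n → κ),
    WildCones.MultP p n κ c₀ → WildCones.Isol p n κ c₀ → CampaignW46.milnorEmbDim p n κ c₀ ≤ 1 →
      ∃ m, 2 * m ≤ WildCones.mu p n κ c₀ + 1 ∧
        (∃ A, WildCones.clean p n κ (WildCones.run p n κ c₀ i t m) A ≠ 0 ∧
          Finset.sum Finset.univ (fun j => A j) = 1) ∧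
        ∀ k < m, WildCones.MultP p n κ (WildCones.run p n κ c₀ i t k) ∧
          WildCones.Isol p n κ (WildCones.run p n κ c₀ i t k) ∧
          CampaignW46.milnorEmbDim p n κ (WildCones.run p n κ c₀ i t k) = CampaignW46.milnorEmbDim p n κ c₀ ∧
          WildCones.mu p n κ (WildCones.run p n κ c₀ i t k) + 2 * k = WildCones.mu p n κ c₀

/-- [OURS · L1 W4.6 rung (ii)] replaces the role of NOTHING printed (dictionary: desk #64's threefold regime IS the
`n = 3` instance of the every-dimension regime); NOT a statement of the manuscript. For every field `κ` of
characteristic `p` and every `p`-fold state `c` of `z^p = a(u₀,u₁,u₂)`: `e(c) ≤ 1 ↔ OrdP c`. Instance `p = 2`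
PROVED by `CampaignW46.HypersurfacesCharTwo.threefold_milnorEmbDim_le_one_iff_ordP`; other `p` not claimed.
[folklore] -/
def CampaignW46ThreefoldsEmbDimIffOrdP (p : ℕ) : Prop :=
  ∀ (κ : Type) [Field κ] [CharP κ p] (c : (Fin 3 → ℕ) → κ),
    WildCones.MultP p 3 κ c → (CampaignW46.milnorEmbDim p 3 κ c ≤ 1 ↔ WildCones.OrdP p 3 κ c)

/-- [OURS · L1 W4.6 rung (ii), every dimension; rev 2] replaces the role of the DETERMINACY of the next centre
(Th. 16.6 p.84 L5–L6: `D′ = ∇′ ∩ π⁻¹(D)` is determined by the data) for hypersurface `p`-fold points in the regime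
`e ≤ 1` of route WildCones' dynamics; NOT a statement of the manuscript. For every field `κ` of characteristic `p`,
every `p`-fold state `c` with `e(c) ≤ 1`, every chart `i` and translations `τ, τ'`: if both successors `step i τ c`,
`step i τ' c` are `p`-fold points then `τ` and `τ'` agree off the chart index — at most ONE infinitely-near `p`-fold
point per chart (at `p = 2`: the kernel of the polar form). Instance `p = 2` PROVED for every `n` by
`CampaignW46.HypersurfacesCharTwo.hypersurface_nearPoint_unique` (p503790; desk #64's
`CampaignW46ThreefoldsNearPointUnique` is `n = 3`); other `p` not claimed. [folklore] -/
def CampaignW46HypersurfacesEmbDimNearPointUnique (p n : ℕ) : Prop :=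
  ∀ (κ : Type) [Field κ] [CharP κ p] (c : (Fin n → ℕ) → κ) (i : Fin n) (τ τ' : Fin n → κ),
    WildCones.MultP p n κ c → CampaignW46.milnorEmbDim p n κ c ≤ 1 →
      WildCones.MultP p n κ (WildCones.step p n κ i τ c) → WildCones.MultP p n κ (WildCones.step p n κ i τ' c) →
        ∀ m ≠ i, τ m = τ' m

/-- [OURS · L1 W4.6 rung (ii), every dimension; rev 2] replaces the role of the EXISTENCE of the next centre of the
iterated procedure (Th. 16.6 p.84 L4–L6; §16.3 p.87 L14–L16) for hypersurface `p`-fold points `z^p = a(u₁,…,uₙ)`,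
`n ≥ 3`, in the regime «isolated, `e = 1`» of route WildCones' dynamics, WITH A NUMBER; NOT a statement of the
manuscript. For every field `κ` of characteristic `p` and every isolated `p`-fold state `c` with `e(c) = 1`: a
`p`-fold point occurs among the successors `step i τ c` iff `μ(c) ≥ 4`. Instance `p = 2` PROVED for every `n ≥ 3` by
`CampaignW46.HypersurfacesCharTwo.hypersurface_exists_double_successor_iff_four_le_mu` (desk #64's
`CampaignW46ThreefoldsNearPointExists` is `n = 3`); other `p` not claimed. [cite: GreuelPfister2026, Thm 3.5 and Cor 3.7] -/
def CampaignW46HypersurfacesEmbDimNearPointExists (p n : ℕ) : Prop :=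
  3 ≤ n → ∀ (κ : Type) [Field κ] [CharP κ p] (c : (Fin n → ℕ) → κ),
    WildCones.MultP p n κ c → WildCones.Isol p n κ c → CampaignW46.milnorEmbDim p n κ c = 1 →
      ((∃ (i : Fin n) (τ : Fin n → κ), WildCones.MultP p n κ (WildCones.step p n κ i τ c)) ↔
        4 ≤ WildCones.mu p n κ c)

/-- [OURS · L1 W4.6 rung (ii), every dimension; rev 2] replaces the role of the LENGTH of the procedure of Th. 16.13
p.87 L25–L28 («finitely many times») for hypersurface `p`-fold points `z^p = a(u₁,…,uₙ)`, `n ≥ 3`, in the regime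
«isolated, `e = 1`», WITH THE EXACT NUMBER; NOT a statement of the manuscript. For every field `κ` of characteristic
`p` and every isolated `p`-fold state `c₀` with `e(c₀) = 1` there are a chart word and a translation word along which
the states `m` with `2m + 2 ≤ μ(c₀)` are isolated `p`-fold points with `e = 1` and `μ + 2m = μ(c₀)`, while the state
`μ(c₀)/2` is NOT a `p`-fold point and carries a LINEAR cleaned monomial (a smooth point): together with
`CampaignW46HypersurfacesEmbDimResolves` the resolution tree above `c₀` is one chain of depth exactly `μ(c₀)/2`.
Instance `p = 2` PROVED for every `n ≥ 3` by `CampaignW46.HypersurfacesCharTwo.hypersurface_singularBranch_exact`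
(desk #64's `CampaignW46ThreefoldsSingularBranch` is `n = 3`); other `p` not claimed.
[cite: GreuelPfister2026, Thm 3.5 and Cor 3.7] -/
def CampaignW46HypersurfacesEmbDimSingularBranch (p n : ℕ) : Prop :=
  3 ≤ n → ∀ (κ : Type) [Field κ] [CharP κ p] (c₀ : (Fin n → ℕ) → κ),
    WildCones.MultP p n κ c₀ → WildCones.Isol p n κ c₀ → CampaignW46.milnorEmbDim p n κ c₀ = 1 →
      ∃ (i : ℕ → Fin n) (t : ℕ → Fin n → κ),
        (∀ m, 2 * m + 2 ≤ WildCones.mu p n κ c₀ →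
          WildCones.MultP p n κ (WildCones.run p n κ c₀ i t m) ∧ WildCones.Isol p n κ (WildCones.run p n κ c₀ i t m) ∧
            CampaignW46.milnorEmbDim p n κ (WildCones.run p n κ c₀ i t m) = 1 ∧
            WildCones.mu p n κ (WildCones.run p n κ c₀ i t m) + 2 * m = WildCones.mu p n κ c₀) ∧
        ¬ WildCones.MultP p n κ (WildCones.run p n κ c₀ i t (WildCones.mu p n κ c₀ / 2)) ∧
        ∃ A, WildCones.clean p n κ (WildCones.run p n κ c₀ i t (WildCones.mu p n κ c₀ / 2)) A ≠ 0 ∧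
          Finset.sum Finset.univ (fun j => A j) = 1

/-- [OURS · L1 W4.6 rung (ii), every dimension; rev 2] replaces the role of NOTHING printed (the dictionary between OUR
invariant and the quadratic form: the FULL-RANK CRITERION); NOT a statement of the manuscript. For every field `κ`
of characteristic `p` and every `p`-fold state `c` of `z^p = a(u₁,…,uₙ)` (`a` the cleaned series): `e(c) + rank P = n`
for the matrix `P = ([u_s u_t] a)_{s ≠ t}` (zero diagonal) of the quadratic part — at `p = 2` the polar (alternating)
form, so `e(c)` IS its corank. Instance `p = 2` PROVED for every `n` by
`CampaignW46.HypersurfacesCharTwo.milnorEmbDim_add_rank_polarMatrix` (p502936, whose `polarMatrix` is this `P`); other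
`p` not claimed. [folklore] -/
def CampaignW46HypersurfacesEmbDimPolarCorank (p n : ℕ) : Prop :=
  ∀ (κ : Type) [Field κ] [CharP κ p] (c : (Fin n → ℕ) → κ), WildCones.MultP p n κ c →
    CampaignW46.milnorEmbDim p n κ c +
      (Matrix.of fun s t : Fin n => if s = t then (0 : κ)
        else MvPowerSeries.coeff (Finsupp.single s 1 + Finsupp.single t 1) (WildCones.ser p n κ c)).rank = n

/-- [OURS · L1 W4.6 rung (ii), every dimension; rev 3] replaces the role of NOTHING printed (bookkeeping of OUR second
invariant); NOT a statement of the manuscript. For every field `κ` of characteristic `p` and every `p`-fold state `c`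
of `z^p = a(u₁,…,uₙ)` with embedding dimension `e(c) = 2`: `h₂(c) ∈ {1, 2, 3}` — at `p = 2`: `3 −` the rank of the
Jacobian pair of quadratic forms of the residual plane cubic. Instance `p = 2` PROVED for every `n` by
`CampaignW46.HypersurfacesCharTwo.milnorHilbertTwo_range` (p512443); other `p` not claimed.
[cite: GreuelPfister2026, Thm 3.5 and Cor 3.7] -/
def CampaignW46HypersurfacesEmbDimTwoHilbertRange (p n : ℕ) : Prop :=
  ∀ (κ : Type) [Field κ] [CharP κ p] (c : (Fin n → ℕ) → κ),
    WildCones.MultP p n κ c → CampaignW46.milnorEmbDim p n κ c = 2 →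
      1 ≤ CampaignW46.milnorHilbertTwo p n κ c ∧ CampaignW46.milnorHilbertTwo p n κ c ≤ 3

/-- [OURS · L1 W4.6 rung (ii), every dimension; rev 3] replaces the role of the centre-type bookkeeping of the
iterated procedure (Th. 16.6 p.84 L4–L6: the next centre `D′ ⊂ ∇′`; §16.3 p.87 L14–L16) — «is the next singular
point again ISOLATED?» — in the class `e = 2`, `h₂ = 3` of hypersurface `p`-fold points; NOT a statement of the
manuscript. For every field `κ` of characteristic `p`, every `p`-fold state `c` with `e(c) = 2` and `h₂(c) = 3` (at
`p = 2`: the residual plane germ has NO tangent cubic — order `≥ 4` modulo squares) and every chart `i`, translation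
`τ` whose successor is a `p`-fold point: the successor is NOT isolated (the state's own isolatedness is not needed).
Instance `p = 2` PROVED for every `n` by
`CampaignW46.HypersurfacesCharTwo.hypersurface_not_isol_step_of_milnorHilbertTwo_eq_three` (p513980); kernel witness of
the class `z² = u₀u₁ + u₂⁵ + u₃⁵` (p507619); other `p` not claimed. [folklore] -/
def CampaignW46HypersurfacesEmbDimTwoNoTangent (p n : ℕ) : Prop :=
  ∀ (κ : Type) [Field κ] [CharP κ p] (c : (Fin n → ℕ) → κ) (i : Fin n) (τ : Fin n → κ),
    WildCones.MultP p n κ c → CampaignW46.milnorEmbDim p n κ c = 2 → CampaignW46.milnorHilbertTwo p n κ c = 3 →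
      WildCones.MultP p n κ (WildCones.step p n κ i τ c) → ¬ WildCones.Isol p n κ (WildCones.step p n κ i τ c)

/-- [OURS · L1 W4.6 rung (ii), every dimension; rev 3] replaces the role of Th. 16.6 (2) Eq. (127) p.84 L9–L16
together with the resolution conclusion of Th. 16.13 p.87 L25–L28 in the sub-case «resolved within TWO blow-ups»
for hypersurface `p`-fold points in the class `e = 2`, `h₂ = 1`; NOT a statement of the manuscript. For every field
`κ` of characteristic `p`, every `p`-fold state `c` with `e(c) = 2` and `h₂(c) = 1` (at `p = 2`: the residual plane
cubic has THREE DISTINCT tangents, the `D₄` configuration) and every chart `i`, translation `τ` whose successor is a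
`p`-fold point: the successor has `e = 0`, is ISOLATED with `μ = 1`, and NONE of its own successors (any chart, any
translation) is a `p`-fold point. Instance `p = 2` PROVED for every `n` by
`CampaignW46.HypersurfacesCharTwo.hypersurface_regime_step_of_milnorHilbertTwo_eq_one` and
`…hypersurface_not_multP_step_step_of_milnorHilbertTwo_eq_one` (p513980); kernel witness of the class
`z² = u₀u₁ + u₂²u₃ + u₂u₃²` (p507619); other `p` not claimed. [folklore] -/
def CampaignW46HypersurfacesEmbDimTwoThreeTangents (p n : ℕ) : Prop :=
  ∀ (κ : Type) [Field κ] [CharP κ p] (c : (Fin n → ℕ) → κ) (i : Fin n) (τ : Fin n → κ),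
    WildCones.MultP p n κ c → CampaignW46.milnorEmbDim p n κ c = 2 → CampaignW46.milnorHilbertTwo p n κ c = 1 →
      WildCones.MultP p n κ (WildCones.step p n κ i τ c) →
        CampaignW46.milnorEmbDim p n κ (WildCones.step p n κ i τ c) = 0 ∧
          WildCones.Isol p n κ (WildCones.step p n κ i τ c) ∧ WildCones.mu p n κ (WildCones.step p n κ i τ c) = 1 ∧
          ∀ (i' : Fin n) (τ' : Fin n → κ), ¬ WildCones.MultP p n κ (WildCones.step p n κ i' τ' (WildCones.step p n κ i τ c))

/-- [OURS · L1 W4.6 rung (ii), every dimension; rev 3] replaces the role of Th. 16.6 (2) Eq. (127) p.84 L9–L16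
TOGETHER WITH the centre-type bookkeeping of the next stage (§16.3 p.87 L14–L18) for ISOLATED hypersurface `p`-fold
points in the class `e = 2`, `h₂ ≤ 2`; NOT a statement of the manuscript. For every field `κ` of characteristic
`p`, every isolated `p`-fold state `c` with `e(c) = 2` and `h₂(c) ≤ 2` (at `p = 2`: the residual plane germ HAS a
tangent cubic — order exactly `3` modulo squares) and every chart `i`, translation `τ` whose successor is a `p`-fold
point: the successor is ISOLATED and `μ(successor) < μ(c)`. Instance `p = 2` PROVED for every `n` by
`CampaignW46.HypersurfacesCharTwo.hypersurface_isol_step_of_milnorHilbertTwo_le_two` (isolatedness transfer through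
the blow-up in ideal arithmetic: `surface_isol_transfer`, p513984; the drop is the crux's `muDrop_two`); other `p` not
claimed. [cite: GreuelPfister2026, Thm 3.5 and Cor 3.7] -/
def CampaignW46HypersurfacesEmbDimTwoIsolated (p n : ℕ) : Prop :=
  ∀ (κ : Type) [Field κ] [CharP κ p] (c : (Fin n → ℕ) → κ) (i : Fin n) (τ : Fin n → κ),
    WildCones.MultP p n κ c → WildCones.Isol p n κ c → CampaignW46.milnorEmbDim p n κ c = 2 →
      CampaignW46.milnorHilbertTwo p n κ c ≤ 2 → WildCones.MultP p n κ (WildCones.step p n κ i τ c) →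
        WildCones.Isol p n κ (WildCones.step p n κ i τ c) ∧
          WildCones.mu p n κ (WildCones.step p n κ i τ c) < WildCones.mu p n κ c

/-- [OURS · L1 W4.6 rung (ii), every dimension; rev 3] replaces the role of the centre-type bookkeeping of the
iterated procedure (Th. 16.6 p.84 L4–L6: the next centre `D′ ⊂ ∇′`; §16.3 p.87 L14–L16) — «is the next singular
point again ISOLATED?» — for ALL isolated hypersurface `p`-fold points, BY A COMPLETE CRITERION on the first two
values of the Hilbert function of the Milnor algebra; NOT a statement of the manuscript. For every field `κ` of
characteristic `p`, every ISOLATED `p`-fold state `c` of `z^p = a(u₁,…,uₙ)` and every chart `i`, translation `τ`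
whose successor is a `p`-fold point: the successor is isolated IFF `e(c) ≤ 1`, or `e(c) = 2` and `h₂(c) ≤ 2`. This
completes rev 1's `CampaignW46HypersurfacesEmbDimTrichotomy` (`e ≤ 1` yes, `e ≥ 3` no, `e = 2` undecided there).
Instance `p = 2` PROVED for every `n` by `CampaignW46.HypersurfacesCharTwo.hypersurface_isol_step_iff`; other `p`
not claimed. [cite: GreuelPfister2026, Thm 3.5 and Cor 3.7] -/
def CampaignW46HypersurfacesIsolStepCriterion (p n : ℕ) : Prop :=
  ∀ (κ : Type) [Field κ] [CharP κ p] (c : (Fin n → ℕ) → κ) (i : Fin n) (τ : Fin n → κ),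
    WildCones.MultP p n κ c → WildCones.Isol p n κ c → WildCones.MultP p n κ (WildCones.step p n κ i τ c) →
      (WildCones.Isol p n κ (WildCones.step p n κ i τ c) ↔
        CampaignW46.milnorEmbDim p n κ c ≤ 1 ∨
          (CampaignW46.milnorEmbDim p n κ c = 2 ∧ CampaignW46.milnorHilbertTwo p n κ c ≤ 2))

/-- [OURS · L1 W4.6 rung (ii), every dimension; rev 3] replaces the role of NOTHING printed (monotonicity of OUR
invariant under the procedure's step; compare the renewal of hypotheses §16.3 p.87 L17–L18); NOT a statement of the
manuscript. For every field `κ` of characteristic `p`, every `p`-fold state `c` of `z^p = a(u₁,…,uₙ)` and every chart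
`i`, translation `τ` whose successor is a `p`-fold point: `e(successor) ≤ e(c)` — the corank of the polar form never
grows under a point blow-up (no isolatedness assumed). Instance `p = 2` PROVED for every `n` by
`CampaignW46.HypersurfacesCharTwo.hypersurface_milnorEmbDim_step_le`; other `p` not claimed.
[cite: GreuelPfister2026, Thm 3.5 and Cor 3.7] -/
def CampaignW46HypersurfacesEmbDimMonotone (p n : ℕ) : Prop :=
  ∀ (κ : Type) [Field κ] [CharP κ p] (c : (Fin n → ℕ) → κ) (i : Fin n) (τ : Fin n → κ),
    WildCones.MultP p n κ c → WildCones.MultP p n κ (WildCones.step p n κ i τ c) →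
      CampaignW46.milnorEmbDim p n κ (WildCones.step p n κ i τ c) ≤ CampaignW46.milnorEmbDim p n κ c

/-- [OURS · L1 W4.6 rung (ii), every dimension; rev 4] replaces the role of NOTHING printed (the structure of OUR invariants
in the three-tangents class); NOT a statement of the manuscript. For every field `κ` of characteristic `p` and every `p`-fold
state `c` of `z^p = a(u₁,…,uₙ)` with `e(c) = 2`: `h₂(c) = 1` IFF `c` is isolated with Milnor number `μ(c) = 4` — at `p = 2`:
the residual plane cubic has three distinct tangents iff the double point is an isolated corank-two point of Milnor number
four (the `D₄` class). Instance `p = 2` PROVED for every `n` by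
`CampaignW46.HypersurfacesCharTwo.hypersurface_milnorHilbertTwo_eq_one_iff` (`…DFour.lean`; `⇐` via `h₂ + e + 1 ≤ μ`,
p517132); kernel witness `z² = u₀u₁ + u₂²u₃ + u₂u₃²` (p517132); other `p` not claimed.
[cite: GreuelPfister2026, Thm 3.5 and Cor 3.7] -/
def CampaignW46HypersurfacesEmbDimTwoDFour (p n : ℕ) : Prop :=
  ∀ (κ : Type) [Field κ] [CharP κ p] (c : (Fin n → ℕ) → κ),
    WildCones.MultP p n κ c → CampaignW46.milnorEmbDim p n κ c = 2 →
      (CampaignW46.milnorHilbertTwo p n κ c = 1 ↔ WildCones.Isol p n κ c ∧ WildCones.mu p n κ c = 4)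

/-- [OURS · L1 W4.6 rung (ii), every dimension; rev 4] replaces the role of Th. 16.6 (2) Eq. (127) p.84 L9–L16 WITH THE
EXACT NUMBER in the three-tangents class of hypersurface `p`-fold points; NOT a statement of the manuscript. For every field
`κ` of characteristic `p`, every `p`-fold state `c` with `e(c) = 2`, `h₂(c) = 1` and every chart `i`, translation `τ` whose
successor is a `p`-fold point: `μ(successor) + 3 = μ(c)` (at `p = 2`: `4 ↦ 1`). Instance `p = 2` PROVED for every `n` by
`CampaignW46.HypersurfacesCharTwo.hypersurface_mu_step_add_three_of_milnorHilbertTwo_eq_one` (`…DFour.lean`); other `p`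
not claimed. [folklore] -/
def CampaignW46HypersurfacesEmbDimTwoDropThree (p n : ℕ) : Prop :=
  ∀ (κ : Type) [Field κ] [CharP κ p] (c : (Fin n → ℕ) → κ) (i : Fin n) (τ : Fin n → κ),
    WildCones.MultP p n κ c → CampaignW46.milnorEmbDim p n κ c = 2 → CampaignW46.milnorHilbertTwo p n κ c = 1 →
      WildCones.MultP p n κ (WildCones.step p n κ i τ c) →
        WildCones.mu p n κ (WildCones.step p n κ i τ c) + 3 = WildCones.mu p n κ c

/-- [OURS · L1 W4.6 rung (ii), every dimension; rev 5] replaces the role of Th. 16.13 p.87 L25–L28 («repeatedly but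
finitely many times») together with the centre-type bookkeeping of §16.3 p.87 L14–L18 for ISOLATED hypersurface `p`-fold
points with `e ≤ 2`, WITH A NUMBER; NOT a statement of the manuscript. For every field `κ` of characteristic `p`, every
isolated `p`-fold state `c₀` with `e(c₀) ≤ 2`, every chart word `i` and translation word `t`: there is an index
`m ≤ μ(c₀)` such that every earlier state is an isolated `p`-fold point and the state `m` is EITHER of multiplicity `< p`
OR a non-isolated `p`-fold point — and then `m ≥ 1` and the state `m - 1` has `(e, h₂) = (2, 3)`: the forced regime is
left sideways only through a «no tangent cubic» state. Instance `p = 2` PROVED for every `n` by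
`CampaignW46.HypersurfacesCharTwo.hypersurface_exit_classification` (p518449); other `p` not claimed. [folklore] -/
def CampaignW46HypersurfacesEmbDimTwoExit (p n : ℕ) : Prop :=
  ∀ (κ : Type) [Field κ] [CharP κ p] (c₀ : (Fin n → ℕ) → κ) (i : ℕ → Fin n) (t : ℕ → Fin n → κ),
    WildCones.Isol p n κ c₀ → CampaignW46.milnorEmbDim p n κ c₀ ≤ 2 →
      ∃ m ≤ WildCones.mu p n κ c₀,
        (∀ k < m, WildCones.MultP p n κ (WildCones.run p n κ c₀ i t k) ∧
          WildCones.Isol p n κ (WildCones.run p n κ c₀ i t k)) ∧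
        (¬ WildCones.MultP p n κ (WildCones.run p n κ c₀ i t m) ∨
          (WildCones.MultP p n κ (WildCones.run p n κ c₀ i t m) ∧
            ¬ WildCones.Isol p n κ (WildCones.run p n κ c₀ i t m) ∧ 1 ≤ m ∧
            CampaignW46.milnorEmbDim p n κ (WildCones.run p n κ c₀ i t (m - 1)) = 2 ∧
            CampaignW46.milnorHilbertTwo p n κ (WildCones.run p n κ c₀ i t (m - 1)) = 3))

end Summit.ResolutionOfSingularities.ResolutionOfSingularities.Theorems

end
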